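import Mathlib.Analysis.InnerProductSpace.PiL2
import Mathlib.Algebra.Module.ZLattice.Covolume
import Mathlib.LinearAlgebra.Matrix.Determinant.Basic
import Mathlib.LinearAlgebra.FiniteDimensional.Lemmas
import Mathlib.MeasureTheory.Measure.Haar.InnerProductSpace
import HarnessLib

-- provenance: harness21/H21/H21/Prelude/Lattice/IntegerBases.lean @ 8dffb85 (interim HEAD d8f2665); M5 mechanical rewrite
/-!
# Integer basis matrices and `ℤ`-lattices in Euclidean space

Trunk: Lattice (prelude), design D1 of the Lattice outline: the bridge from *integer basis
matrices* (the input format of the computational lattice problems SVP, CVP, GapSVP, SIVP, BDD of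
Micciancio–Goldwasser 2002, Ch. 1, and Peikert 2016, §2.2) to Mathlib's `ℤ`-lattices
(`Submodule ℤ E` with `DiscreteTopology` and `IsZLattice ℝ`).

## Main definitions

* `Literature.Lattice.intVecToEuclidean n`: the `ℤ`-linear embedding `ℤⁿ → ℝⁿ = EuclideanSpace ℝ (Fin n)`.
* `Literature.Algebra.EuclideanLattices.LatticeInstance`: a natural number `n` and an integer matrix
  `basis : Matrix (Fin n) (Fin n) ℤ` whose ROWS are the basis vectors `b₁, …, bₙ ∈ ℤⁿ`.
* `Literature.Lattice.LatticeInstance.lattice I`: the lattice `L(B) = span_ℤ {b₁, …, bₙ} ⊆ ℝⁿ`.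
* `Literature.Lattice.LatticeInstance.IsNonsingular I`: `det B ≠ 0` (the rows are a basis of `ℝⁿ`).
* `Literature.Lattice.stdIntLattice n`: the standard lattice `ℤⁿ ⊆ ℝⁿ`.
* `Literature.Algebra.EuclideanLattices.LatticeInstance.basisOfIsNonsingular`: the rows as a `Basis (Fin n) ℝ ℝⁿ` when
  `det B ≠ 0`, so that `I.lattice = span ℤ (range b)` is literally an instance of the accepted
  Wave0 notion `Literature.PQC.latticeOfBasis b` (statement pqc.S10 in `H21/Statements/PQC/Wave0.lean`,
  which is cited but deliberately not imported from this prelude file).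

## Main results

* `LatticeInstance.instDiscreteTopologyLattice`: `L(B)` is discrete (it sits inside `ℤⁿ`).
* `LatticeInstance.isZLattice_of_isNonsingular`: if `det B ≠ 0` then `L(B)` is a full lattice.
* `LatticeInstance.covolume_lattice_eq_abs_det`: `covol L(B) = |det B|`
  (Micciancio–Goldwasser 2002, Def. 1.6; the Euclidean-space analogue of Mathlib's
  `ZLattice.covolume_eq_det` and of Wave0's `Literature.PQC.latticeDet_latticeOfBasis_eq_abs_det`).

## Implementation notes

Everything used here is Mathlib: `EuclideanSpace`, `WithLp.toLp`, `EuclideanSpace.basisFun`,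
`Matrix.linearIndependent_rows_of_det_ne_zero`, `basisOfLinearIndependentOfCardEqFinrank'`,
the `ZSpan` instances `DiscreteTopology (span ℤ (range b))` / `instIsZLatticeRealSpan`, and
`ZLattice.covolume`.  We do not introduce a new name for the lattice determinant: use
`ZLattice.covolume` directly.  `stdIntLattice` is spanned by `(EuclideanSpace.basisFun _ ℝ).toBasis`
(rather than the bare orthonormal basis) so that the `ZSpan` instances apply syntactically.

`LatticeInstance.IsNonsingular` is VOCABULARY (a decidable predicate `LatticeInstance → Prop`, the
hypothesis `det B ≠ 0` of Micciancio–Goldwasser 2002, Ch. 1, Def. 1.1), not a named fact: there is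
no `IsNonsingular_holds`, and `not_forall_isNonsingular` (end of this file) shows its universal
closure is false.  Its characterisations (`isNonsingular_iff_linearIndependent`,
`isNonsingular_iff_span_range_vec_eq_top`, `isNonsingular_iff_isZLattice`) are proved below.
-/

noncomputable section

open Module Submodule MeasureTheory

namespace Literature.Algebra.EuclideanLattices

/-- The canonical `ℤ`-linear embedding `ℤⁿ ↪ ℝⁿ`, `v ↦ (v j : ℝ)_j`, with values in
`EuclideanSpace ℝ (Fin n)` (so that `‖·‖` is the Euclidean norm).  Standard; cf.
Micciancio–Goldwasser 2002, Ch. 1 §1 (lattices with integer bases). [cite: MicciancioGoldwasser2002, Ch. 1 §1 (lattices with integer bases] -/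
def intVecToEuclidean (n : ℕ) : (Fin n → ℤ) →ₗ[ℤ] EuclideanSpace ℝ (Fin n) where
  toFun v := WithLp.toLp 2 fun j => (v j : ℝ)
  map_add' v w := by ext j; simp
  map_smul' c v := by ext j; simp

/-- `intVecToEuclidean_apply` — interim theorem carried over undocumented from `harness21/H21/H21/Prelude/Lattice/IntegerBases.lean:61` (docstring generated by the M5 import). [folklore] -/
@[simp]
theorem intVecToEuclidean_apply (n : ℕ) (v : Fin n → ℤ) (j : Fin n) :
    intVecToEuclidean n v j = (v j : ℝ) := rfl

/-- The embedding `ℤⁿ ↪ ℝⁿ` is injective (Micciancio–Goldwasser 2002, Ch. 1 §1). [cite: MicciancioGoldwasser2002, Ch. 1 §1] -/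
theorem intVecToEuclidean_injective (n : ℕ) : Function.Injective (intVecToEuclidean n) := by
  intro v w h
  ext j
  have := congrArg (fun x : EuclideanSpace ℝ (Fin n) => x j) h
  simpa using this

/-- Norm formula: `‖v‖ = √(∑ⱼ vⱼ²)` for an integer vector viewed in `ℝⁿ`
(Micciancio–Goldwasser 2002, Ch. 1 §1, Euclidean norm). [cite: MicciancioGoldwasser2002, Ch. 1 §1  Euclidean norm] -/
theorem norm_intVecToEuclidean (n : ℕ) (v : Fin n → ℤ) :
    ‖intVecToEuclidean n v‖ = √(∑ j, ((v j : ℝ)) ^ 2) := by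
  rw [EuclideanSpace.norm_eq]
  simp [Real.norm_eq_abs, sq_abs]

/-- A *lattice instance*: the input of the computational lattice problems (SVP, CVP, GapSVP, …;
Micciancio–Goldwasser 2002, Ch. 1, Def. 1.1 and §1.2; Peikert 2016, §2.2).  It consists of a
dimension `n` and an integer matrix `basis ∈ ℤⁿˣⁿ` whose ROWS `basis i : Fin n → ℤ` are the
generating vectors `b₁, …, bₙ`.  We do not require `det basis ≠ 0` in the structure (see
`LatticeInstance.IsNonsingular`); the generated subgroup is a (possibly non-full) lattice in any
case. [cite: MicciancioGoldwasser2002, Ch. 1  Def. 1.1 and §1.2] -/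
structure LatticeInstance where
  /-- The ambient dimension `n`. -/
  n : ℕ
  /-- The basis matrix; its rows are the lattice vectors `b₁, …, bₙ ∈ ℤⁿ`. -/
  basis : Matrix (Fin n) (Fin n) ℤ

namespace LatticeInstance

variable (I : LatticeInstance)

/-- The `i`-th basis vector `bᵢ ∈ ℝⁿ` of a lattice instance (the `i`-th row of the matrix,
cast to `ℝ`); Micciancio–Goldwasser 2002, Ch. 1, Def. 1.1. [cite: MicciancioGoldwasser2002, Ch. 1  Def. 1.1] -/
def vec (i : Fin I.n) : EuclideanSpace ℝ (Fin I.n) :=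
  intVecToEuclidean I.n (I.basis i)

/-- `vec_apply` — interim theorem carried over undocumented from `harness21/H21/H21/Prelude/Lattice/IntegerBases.lean:100` (docstring generated by the M5 import). [folklore] -/
@[simp]
theorem vec_apply (i j : Fin I.n) : I.vec i j = (I.basis i j : ℝ) := rfl

/-- The lattice `L(B) = {∑ᵢ zᵢ bᵢ | z ∈ ℤⁿ} = span_ℤ {b₁, …, bₙ} ⊆ ℝⁿ` generated by the rows of
the instance (Micciancio–Goldwasser 2002, Ch. 1, Def. 1.1; Peikert 2016, Def. 2.1.1). [cite: MicciancioGoldwasser2002, Ch. 1  Def. 1.1] -/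
def lattice : Submodule ℤ (EuclideanSpace ℝ (Fin I.n)) :=
  span ℤ (Set.range I.vec)

/-- The instance is *nonsingular* if `det B ≠ 0`, i.e. the rows `b₁, …, bₙ` are `ℝ`-linearly
independent (`isNonsingular_iff_linearIndependent`), equivalently `L(B)` is a full-rank lattice in
`ℝⁿ` (`isNonsingular_iff_isZLattice`).  This is a PREDICATE on instances (a hypothesis, the
instance `I` being an explicit argument) — the standing assumption "`b₁, …, bₙ` linearly
independent" that Micciancio–Goldwasser 2002, Ch. 1, Def. 1.1 places on a lattice basis
(equivalently "let `x₁, …, xₙ` be a basis of `ℝⁿ`", Bremner 2011, §1.2, Def. 1.9), specialised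
to a square integer basis matrix — and not a closed proposition or a published result to
discharge: it holds for `B = 1` and fails for `B = 0` in every dimension `n ≥ 1`
(`isNonsingular_one`, `not_isNonsingular_zero`, `not_forall_isNonsingular` below), so there is no
`IsNonsingular_holds` to expect; users keep the hypothesis `(h : I.IsNonsingular)`.  (The binder is
written explicitly and the source is given as prose rather than a fact tag so that the
definition is not read as a named fact; the constant
`LatticeInstance.IsNonsingular : LatticeInstance → Prop` is unchanged.) [folklore] -/
def IsNonsingular (I : LatticeInstance) : Prop :=
  I.basis.det ≠ 0

/-- `instance` — interim instance carried over undocumented from `harness21/H21/H21/Prelude/Lattice/IntegerBases.lean:113` (docstring generated by the M5 import). [folklore] -/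
instance : DecidablePred IsNonsingular := fun I =>
  inferInstanceAs (Decidable (I.basis.det ≠ 0))

/-- The lattice vector `B ᵀ z = ∑ᵢ zᵢ bᵢ ∈ ℝⁿ` with integer coefficient vector `z ∈ ℤⁿ`
(row convention: `z ᵥ* B`); Micciancio–Goldwasser 2002, Ch. 1, Def. 1.1. [cite: MicciancioGoldwasser2002, Ch. 1  Def. 1.1] -/
def ofCoeffs (z : Fin I.n → ℤ) : EuclideanSpace ℝ (Fin I.n) :=
  intVecToEuclidean I.n (Matrix.vecMul z I.basis)

/-- `ofCoeffs_eq_sum` — interim theorem carried over undocumented from `harness21/H21/H21/Prelude/Lattice/IntegerBases.lean:121` (docstring generated by the M5 import). [folklore] -/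
theorem ofCoeffs_eq_sum (z : Fin I.n → ℤ) : I.ofCoeffs z = ∑ i, z i • I.vec i := by
  simp only [ofCoeffs, Matrix.vecMul_eq_sum, map_sum, map_zsmul, vec]

/-- Every integer combination `∑ᵢ zᵢ bᵢ` lies in `L(B)` (Micciancio–Goldwasser 2002, Ch. 1,
Def. 1.1). [cite: MicciancioGoldwasser2002, Ch. 1  Def. 1.1] -/
theorem ofCoeffs_mem_lattice (z : Fin I.n → ℤ) : I.ofCoeffs z ∈ I.lattice := by
  rw [ofCoeffs_eq_sum]
  exact sum_mem fun i _ => Submodule.smul_mem _ _ (subset_span (Set.mem_range_self i))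

/-- `x ∈ L(B)` iff `x = ∑ᵢ zᵢ bᵢ` for some `z ∈ ℤⁿ` (Micciancio–Goldwasser 2002, Ch. 1,
Def. 1.1). [cite: MicciancioGoldwasser2002, Ch. 1  Def. 1.1] -/
theorem mem_lattice_iff (x : EuclideanSpace ℝ (Fin I.n)) :
    x ∈ I.lattice ↔ ∃ z : Fin I.n → ℤ, I.ofCoeffs z = x := by
  simp only [lattice, Submodule.mem_span_range_iff_exists_fun, ofCoeffs_eq_sum]

end LatticeInstance

/-- The standard integer lattice `ℤⁿ = span_ℤ {e₁, …, eₙ} ⊆ ℝⁿ` (Micciancio–Goldwasser 2002,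
Ch. 1 §1), spanned by the standard orthonormal basis `EuclideanSpace.basisFun` (as a `Basis`,
so that Mathlib's `ZSpan` instances `DiscreteTopology`/`IsZLattice` apply). [cite: MicciancioGoldwasser2002, Ch. 1 §1] -/
def stdIntLattice (n : ℕ) : Submodule ℤ (EuclideanSpace ℝ (Fin n)) :=
  span ℤ (Set.range ((EuclideanSpace.basisFun (Fin n) ℝ).toBasis))

/-- `mem_stdIntLattice_iff` — interim theorem carried over undocumented from `harness21/H21/H21/Prelude/Lattice/IntegerBases.lean:144` (docstring generated by the M5 import). [folklore] -/
theorem mem_stdIntLattice_iff {n : ℕ} (x : EuclideanSpace ℝ (Fin n)) :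
    x ∈ stdIntLattice n ↔ ∀ j, ∃ k : ℤ, (k : ℝ) = x j := by
  rw [stdIntLattice, Basis.mem_span_iff_repr_mem]
  rfl

/-- `instance` — interim instance carried over undocumented from `harness21/H21/H21/Prelude/Lattice/IntegerBases.lean:149` (docstring generated by the M5 import). [folklore] -/
instance (n : ℕ) : DiscreteTopology (stdIntLattice n) :=
  inferInstanceAs (DiscreteTopology (span ℤ (Set.range ((EuclideanSpace.basisFun (Fin n) ℝ).toBasis))))

/-- `instance` — interim instance carried over undocumented from `harness21/H21/H21/Prelude/Lattice/IntegerBases.lean:152` (docstring generated by the M5 import). [folklore] -/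
instance (n : ℕ) : IsZLattice ℝ (stdIntLattice n) :=
  inferInstanceAs (IsZLattice ℝ (span ℤ (Set.range ((EuclideanSpace.basisFun (Fin n) ℝ).toBasis))))

/-- `intVecToEuclidean_mem_stdIntLattice` — interim theorem carried over undocumented from `harness21/H21/H21/Prelude/Lattice/IntegerBases.lean:155` (docstring generated by the M5 import). [folklore] -/
theorem intVecToEuclidean_mem_stdIntLattice (n : ℕ) (v : Fin n → ℤ) :
    intVecToEuclidean n v ∈ stdIntLattice n :=
  (mem_stdIntLattice_iff _).2 fun j => ⟨v j, rfl⟩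

namespace LatticeInstance

variable (I : LatticeInstance)

/-- An integer lattice is contained in `ℤⁿ` (Micciancio–Goldwasser 2002, Ch. 1 §1). [cite: MicciancioGoldwasser2002, Ch. 1 §1] -/
theorem lattice_le_stdIntLattice : I.lattice ≤ stdIntLattice I.n := by
  refine span_le.2 ?_
  rintro _ ⟨i, rfl⟩
  exact intVecToEuclidean_mem_stdIntLattice _ _

/-- `L(B)` is a discrete subgroup of `ℝⁿ`, being contained in `ℤⁿ` (Micciancio–Goldwasser 2002,
Ch. 1, Def. 1.1: "a lattice is a discrete additive subgroup"). [cite: MicciancioGoldwasser2002, Ch. 1  Def. 1.1: "a lattice is a discret] -/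
instance instDiscreteTopologyLattice : DiscreteTopology I.lattice :=
  DiscreteTopology.of_subset (s := (stdIntLattice I.n : Set (EuclideanSpace ℝ (Fin I.n))))
    (inferInstanceAs (DiscreteTopology (stdIntLattice I.n))) I.lattice_le_stdIntLattice

/-- `det_map_cast_ne_zero` — interim theorem carried over undocumented from `harness21/H21/H21/Prelude/Lattice/IntegerBases.lean:175` (docstring generated by the M5 import). [folklore] -/
theorem det_map_cast_ne_zero {I : LatticeInstance} (h : I.IsNonsingular) :
    (I.basis.map (Int.cast : ℤ → ℝ)).det ≠ 0 := by
  rw [← Int.cast_det]; exact_mod_cast h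

/-- If `det B ≠ 0` the rows `b₁, …, bₙ` are `ℝ`-linearly independent in `ℝⁿ`
(Micciancio–Goldwasser 2002, Ch. 1, Def. 1.1). [cite: MicciancioGoldwasser2002, Ch. 1  Def. 1.1] -/
theorem linearIndependent_vec {I : LatticeInstance} (h : I.IsNonsingular) :
    LinearIndependent ℝ I.vec := by
  have hli := Matrix.linearIndependent_rows_of_det_ne_zero (det_map_cast_ne_zero h)
  have := hli.map' _ (WithLp.linearEquiv 2 ℝ (Fin I.n → ℝ)).symm.ker
  have e : I.vec = (WithLp.linearEquiv 2 ℝ (Fin I.n → ℝ)).symm ∘ fun i => I.basis.map Int.cast i := by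
    funext i; ext j; simp [WithLp.linearEquiv_symm_apply]
  rw [e]; exact this

/-- If `det B ≠ 0`, the rows of `B` form an `ℝ`-basis of `ℝⁿ` (Micciancio–Goldwasser 2002,
Ch. 1, Def. 1.1); this links `LatticeInstance` to the real bases `b : Basis ι ℝ E` of the Wave0
statements (`Literature.Computability.Cryptography.latticeOfBasis`). [cite: MicciancioGoldwasser2002, Ch. 1  Def. 1.1] -/
def basisOfIsNonsingular {I : LatticeInstance} (h : I.IsNonsingular) :
    Basis (Fin I.n) ℝ (EuclideanSpace ℝ (Fin I.n)) :=
  basisOfLinearIndependentOfCardEqFinrank' I.vec (linearIndependent_vec h) (by simp)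

/-- `coe_basisOfIsNonsingular` — interim theorem carried over undocumented from `harness21/H21/H21/Prelude/Lattice/IntegerBases.lean:197` (docstring generated by the M5 import). [folklore] -/
@[simp]
theorem coe_basisOfIsNonsingular {I : LatticeInstance} (h : I.IsNonsingular) :
    ⇑(basisOfIsNonsingular h) = I.vec :=
  coe_basisOfLinearIndependentOfCardEqFinrank' _ _ _

/-- `L(B) = span_ℤ (range b)` for the real basis `b` of rows; the right-hand side is
definitionally Wave0's `Literature.PQC.latticeOfBasis (basisOfIsNonsingular h)`
(Micciancio–Goldwasser 2002, Ch. 1, Def. 1.1). [cite: MicciancioGoldwasser2002, Ch. 1  Def. 1.1] -/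
theorem lattice_eq_span_basisOfIsNonsingular {I : LatticeInstance} (h : I.IsNonsingular) :
    I.lattice = span ℤ (Set.range ⇑(basisOfIsNonsingular h)) := by
  rw [coe_basisOfIsNonsingular]; rfl

/-- If `det B ≠ 0` then `L(B)` is a full-rank `ℤ`-lattice in `ℝⁿ` (Micciancio–Goldwasser 2002,
Ch. 1, Def. 1.1; Mathlib's `instIsZLatticeRealSpan`). Stated as a theorem (the hypothesis is
not a typeclass); use `haveI := I.isZLattice_of_isNonsingular h`. [cite: MicciancioGoldwasser2002, Ch. 1  Def. 1.1] -/
theorem isZLattice_of_isNonsingular {I : LatticeInstance} (h : I.IsNonsingular) :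
    IsZLattice ℝ I.lattice := by
  refine ⟨?_⟩
  rw [lattice_eq_span_basisOfIsNonsingular h]
  exact ZSpan.span_top _

/-- Determinant of an integer lattice: `covol L(B) = |det B|` for a nonsingular integer basis
matrix `B` (Micciancio–Goldwasser 2002, Ch. 1, Def. 1.6; Peikert 2016, §2.1).  This is the
`EuclideanSpace` analogue of Mathlib's `ZLattice.covolume_eq_det` and of the accepted Wave0
lemma `Literature.PQC.latticeDet_latticeOfBasis_eq_abs_det` (statement pqc.S10), with `volume` the
Lebesgue measure of the inner product space `ℝⁿ`. [cite: MicciancioGoldwasser2002, Ch. 1  Def. 1.6] -/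
theorem covolume_lattice_eq_abs_det {I : LatticeInstance} (h : I.IsNonsingular) :
    ZLattice.covolume I.lattice = |(I.basis.map (Int.cast : ℤ → ℝ)).det| := by
  classical
  let b₀ := (EuclideanSpace.basisFun (Fin I.n) ℝ).toBasis
  rw [lattice_eq_span_basisOfIsNonsingular h,
    ZLattice.covolume_eq_measure_fundamentalDomain _ _
      (ZSpan.isAddFundamentalDomain (basisOfIsNonsingular h) volume),
    ZSpan.measureReal_fundamentalDomain (basisOfIsNonsingular h) volume b₀,
    measureReal_congr (ZSpan.fundamentalDomain_ae_parallelepiped b₀ volume)]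
  have h1 : volume.real (parallelepiped b₀) = 1 := by
    simp [measureReal_def, b₀, OrthonormalBasis.volume_parallelepiped]
  rw [h1, mul_one, Basis.det_apply, ← Matrix.det_transpose (I.basis.map _)]
  congr 2
  ext i j
  simp [Basis.toMatrix_apply, b₀]

end LatticeInstance

end Literature.Algebra.EuclideanLattices

/-! ### The predicate `IsNonsingular`: characterisations and (non-)examples

`LatticeInstance.IsNonsingular : LatticeInstance → Prop` is a *hypothesis on an instance* — the
standing assumption "`b₁, …, bₙ` linearly independent" of Micciancio–Goldwasser 2002, Ch. 1,
Def. 1.1 (equivalently "`x₁, …, xₙ` is a basis of `ℝⁿ`", Bremner 2011, *Lattice Basis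
Reduction*, §1.2 Def. 1.9), specialised to a square integer basis matrix — and not a closed
proposition: it holds for the identity matrix and fails for the zero matrix in every dimension
`n ≥ 1` (`not_forall_isNonsingular`).  The lemmas below record this and prove the two paraphrases used in
its docstring: `det B ≠ 0` iff the rows are `ℝ`-linearly independent iff `L(B)` is a full-rank
`ℤ`-lattice (`IsZLattice`).  (The degenerate case `n = 0`, where every instance is nonsingular,
is `Literature.Algebra.EuclideanLattices.isNonsingular_of_n_eq_zero` in `GapCVPPrime.lean`.) -/

namespace Literature.Algebra.EuclideanLattices

namespace LatticeInstance

variable (I : LatticeInstance)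

/-- Unfolding lemma: `I.IsNonsingular ↔ det B ≠ 0` (Micciancio–Goldwasser 2002, Ch. 1, Def. 1.1,
nonsingular basis matrix). [cite: MicciancioGoldwasser2002, Ch. 1 Def. 1.1] -/
theorem isNonsingular_iff : I.IsNonsingular ↔ I.basis.det ≠ 0 := Iff.rfl

/-- `det B ≠ 0` over `ℤ` iff `det B ≠ 0` for the real matrix with the same entries. [folklore] -/
theorem isNonsingular_iff_det_map_cast_ne_zero :
    I.IsNonsingular ↔ (I.basis.map (Int.cast : ℤ → ℝ)).det ≠ 0 := by
  rw [IsNonsingular, ← Int.cast_det, Int.cast_ne_zero]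

/-- `det B ≠ 0` iff the real matrix `B` is invertible. [folklore] -/
theorem isNonsingular_iff_isUnit :
    I.IsNonsingular ↔ IsUnit (I.basis.map (Int.cast : ℤ → ℝ)) := by
  rw [isNonsingular_iff_det_map_cast_ne_zero, Matrix.isUnit_iff_isUnit_det, isUnit_iff_ne_zero]

/-- The rows of the real matrix `B` are the vectors `bᵢ` read in `Fin n → ℝ` (i.e. transported
along `EuclideanSpace ℝ (Fin n) ≃ₗ[ℝ] (Fin n → ℝ)`). [folklore] -/
theorem row_map_cast_eq_comp_vec :
    (I.basis.map (Int.cast : ℤ → ℝ)).row = (WithLp.linearEquiv 2 ℝ (Fin I.n → ℝ)) ∘ I.vec := by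
  funext i j
  simp [Matrix.row]

/-- `det B ≠ 0` iff the rows `b₁, …, bₙ ∈ ℝⁿ` are linearly independent — the form in which
Micciancio–Goldwasser 2002, Ch. 1, Def. 1.1 states the hypothesis ("`n` linearly independent
vectors `b₁, …, bₙ`"). [cite: MicciancioGoldwasser2002, Ch. 1 Def. 1.1] -/
theorem isNonsingular_iff_linearIndependent : I.IsNonsingular ↔ LinearIndependent ℝ I.vec := by
  refine ⟨linearIndependent_vec, fun h => ?_⟩
  rw [isNonsingular_iff_isUnit, ← Matrix.linearIndependent_rows_iff_isUnit,
    row_map_cast_eq_comp_vec]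
  exact h.map' _ (LinearEquiv.ker _)

/-- The real span of `L(B)` is the real span of the rows. [folklore] -/
theorem span_real_lattice_eq_span_range_vec :
    span ℝ (I.lattice : Set (EuclideanSpace ℝ (Fin I.n))) = span ℝ (Set.range I.vec) :=
  span_span_of_tower ℤ ℝ (Set.range I.vec)

/-- `det B ≠ 0` iff the rows `b₁, …, bₙ` span `ℝⁿ` (for `n` vectors in `ℝⁿ`, spanning and linear
independence are equivalent); this is the form "`x₁, …, xₙ` a basis of `ℝⁿ`" in which Bremner 2011,
§1.2, Def. 1.9 (p. 5) states the hypothesis of a lattice basis, row convention as here.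
[cite: Bremner2011, §1.2 Def. 1.9] -/
theorem isNonsingular_iff_span_range_vec_eq_top :
    I.IsNonsingular ↔ span ℝ (Set.range I.vec) = ⊤ := by
  rw [isNonsingular_iff_linearIndependent]
  refine ⟨fun h => ?_,
    fun h => linearIndependent_of_top_le_span_of_card_eq_finrank h.ge (by simp)⟩
  rw [← coe_basisOfIsNonsingular ((isNonsingular_iff_linearIndependent I).2 h)]
  exact Basis.span_eq _

/-- `det B ≠ 0` iff `L(B)` is a *full-rank* lattice in `ℝⁿ`, i.e. a `ℤ`-lattice in Mathlib's sense
(`IsZLattice`: discrete — automatic here — and spanning `ℝⁿ` over `ℝ`); Micciancio–Goldwasser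
2002, Ch. 1, Def. 1.1 ("full rank" / "full dimensional" when `n = m`).
[cite: MicciancioGoldwasser2002, Ch. 1 Def. 1.1] -/
theorem isNonsingular_iff_isZLattice : I.IsNonsingular ↔ IsZLattice ℝ I.lattice := by
  refine ⟨isZLattice_of_isNonsingular, fun h => ?_⟩
  rw [isNonsingular_iff_span_range_vec_eq_top, ← span_real_lattice_eq_span_range_vec]
  exact h.span_top

/-- The identity instance (`B = 1`, rows `e₁, …, eₙ`) is nonsingular: the predicate is
satisfiable in every dimension. [folklore] -/
theorem isNonsingular_one (n : ℕ) : (⟨n, 1⟩ : LatticeInstance).IsNonsingular := by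
  simp [IsNonsingular]

/-- The zero matrix is singular in every dimension `n ≥ 1`. [folklore] -/
theorem not_isNonsingular_zero {n : ℕ} (hn : n ≠ 0) :
    ¬ (⟨n, 0⟩ : LatticeInstance).IsNonsingular := by
  haveI : Nonempty (Fin n) := Fin.pos_iff_nonempty.mp (Nat.pos_of_ne_zero hn)
  simp [IsNonsingular, Matrix.det_zero]

/-- `IsNonsingular` is a genuine hypothesis (Micciancio–Goldwasser 2002, Ch. 1, Def. 1.1 *assumes*
linear independence), not a theorem about all integer matrices: it fails for the `1 × 1` zero
matrix.  In particular there is no `IsNonsingular_holds`; users keep `(h : I.IsNonsingular)`.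
[folklore] -/
theorem not_forall_isNonsingular : ¬ ∀ I : LatticeInstance, I.IsNonsingular := fun h =>
  not_isNonsingular_zero one_ne_zero (h _)

end LatticeInstance

end Literature.Algebra.EuclideanLattices
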